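import Mathlib

/-!
# Route LevelSetModeration — crux `LevelSetClosure`: time integration of the slice gain (stub S3)

Support lemma for item stmt-NavierStokesRegularity-18150 (line `Sketch-ideator2`, volume
bookkeeping of the De Giorgi iteration for the speed `|u|` of a Navier–Stokes solution).

Write `V(h) = ∫⁻ τ ∈ (0,T), vol{h < |u τ|}` and `d_k(τ) = ∫⁻ 1_{k<|u τ|} ‖∇|u τ|‖²`. If every slice
`τ ∈ (0,T)` obeys the volume gain `vol{h < |u τ|} ≤ C (∫⁻ (|u τ|-k)₊²)^{2/3} d_k(τ)` and the truncated
energy is uniformly bounded, `∫ (|u τ|-k)₊² ≤ S`, then `V(h) ≤ C S^{2/3} ∫⁻ τ ∈ (0,T), d_k(τ)`.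

The proof is pure measure theory: a pointwise bound on `(0,T)` (`setLIntegral_mono'`, no
measurability in `τ` needed), the identification `∫⁻ ofReal f = ofReal (∫ f)` for an integrable
nonnegative `f`, monotonicity of `x ↦ x^{2/3}` on `ℝ≥0∞`, and pulling the finite constant
`C S^{2/3}` out of the outer lower Lebesgue integral (`lintegral_const_mul'`, which is where `C ≠ ⊤`
is used). No sign condition on `S` is needed: `ENNReal.ofReal` is monotone on all of `ℝ`.
-/

noncomputable section

-- single-conjunct summit: `Summit.<Summit>.<Problem>` repeats the name by the D-0017 layout
set_option linter.dupNamespace false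

namespace Summit.NavierStokesRegularity.NavierStokesRegularity.Theorems.LevelSetClosure

open MeasureTheory
open scoped ENNReal NNReal

/-- **Stub S3 (time integration of the slice gain).** If every slice `τ ∈ (0,T)` obeys a volume
gain with constant `C ≠ ⊤` and its truncated energy at level `k` is at most `S`, then the space–time
volume of `{|u| > h}` is at most `C S^{2/3}` times the level-set dissipation at level `k`. -/
theorem stub_timeStep :
    ∀ (u : ℝ → EuclideanSpace ℝ (Fin 3) → EuclideanSpace ℝ (Fin 3)) (T k h S : ℝ) (C : ℝ≥0∞),
      C ≠ ⊤ →
      (∀ τ ∈ Set.Ioo 0 T, MeasureTheory.Integrable (fun x => (max (‖u τ x‖ - k) 0) ^ 2) volume) →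
      (∀ τ ∈ Set.Ioo 0 T, ∫ x, (max (‖u τ x‖ - k) 0) ^ 2 ≤ S) →
      (∀ τ ∈ Set.Ioo 0 T, volume {x | h < ‖u τ x‖} ≤
        C * (∫⁻ x, ENNReal.ofReal ((max (‖u τ x‖ - k) 0) ^ 2)) ^ (2 / 3 : ℝ) *
          ∫⁻ x, Set.indicator {x | k < ‖u τ x‖}
            (fun x => ENNReal.ofReal (‖fderiv ℝ (fun y => ‖u τ y‖) x‖ ^ 2)) x) →
      (∫⁻ τ in Set.Ioo 0 T, volume {x | h < ‖u τ x‖}) ≤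
        C * ENNReal.ofReal S ^ (2 / 3 : ℝ) *
          ∫⁻ τ in Set.Ioo 0 T, ∫⁻ x, Set.indicator {x | k < ‖u τ x‖}
            (fun x => ENNReal.ofReal (‖fderiv ℝ (fun y => ‖u τ y‖) x‖ ^ 2)) x := by
  intro u T k h S C hC hint hbound hgain
  -- the constant `C S^{2/3}` is finite, so it can be pulled out of the outer integral
  have hr : C * ENNReal.ofReal S ^ (2 / 3 : ℝ) ≠ ⊤ :=
    ENNReal.mul_ne_top hC (ENNReal.rpow_ne_top_of_nonneg (by norm_num) ENNReal.ofReal_ne_top)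
  calc (∫⁻ τ in Set.Ioo 0 T, volume {x | h < ‖u τ x‖})
      ≤ ∫⁻ τ in Set.Ioo 0 T, C * ENNReal.ofReal S ^ (2 / 3 : ℝ) *
          ∫⁻ x, Set.indicator {x | k < ‖u τ x‖}
            (fun x => ENNReal.ofReal (‖fderiv ℝ (fun y => ‖u τ y‖) x‖ ^ 2)) x := by
        refine setLIntegral_mono' measurableSet_Ioo fun τ hτ => (hgain τ hτ).trans ?_
        -- slice: `∫⁻ ofReal (|u τ|-k)₊² = ofReal (∫ (|u τ|-k)₊²) ≤ ofReal S`
        have hX : (∫⁻ x, ENNReal.ofReal ((max (‖u τ x‖ - k) 0) ^ 2)) ≤ ENNReal.ofReal S := by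
          rw [← ofReal_integral_eq_lintegral_ofReal (hint τ hτ)
            (Filter.Eventually.of_forall fun x => sq_nonneg _)]
          exact ENNReal.ofReal_le_ofReal (hbound τ hτ)
        gcongr
    _ = C * ENNReal.ofReal S ^ (2 / 3 : ℝ) *
          ∫⁻ τ in Set.Ioo 0 T, ∫⁻ x, Set.indicator {x | k < ‖u τ x‖}
            (fun x => ENNReal.ofReal (‖fderiv ℝ (fun y => ‖u τ y‖) x‖ ^ 2)) x :=
        lintegral_const_mul' _ _ hr

end Summit.NavierStokesRegularity.NavierStokesRegularity.Theorems.LevelSetClosure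

end
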